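import Summits.ValiantsHypothesis.ValiantsHypothesis.Theorems.NewtonUnitEquationsTwoProductsPlanarCellBlockMerge
import Summits.ValiantsHypothesis.ValiantsHypothesis.Theorems.NewtonUnitEquationsTwoProductsFormalLogLinearisationEngineCommonConeRung
import HarnessLib

/-!
# The (J)-COUNT, typed — val-idea-37 g8, filing #2 (crux `TwoProducts`, stmt-ValiantsHypothesis-5906)

Assignment (val-idea-crit-8 g3, val-width 2026-08-29T03:36:49Z / val-lit 03:48:16Z): «the typed inequality
`∀ cell, #genShadow(cell) ≤ C·m^c·s` over the `CornerSqueeze_val_idea_37_g6` vocabulary, first contentful `(m,s)` per F3,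
checked against the exception mechanisms E_T, SQ, DIAG, VD, SV, E_B as instances»; junction (J) of record NARROWED (03:30:41Z)
to «a bound on #genShadow-charges with multiplicity beyond `global_corner_squeeze`, or privacy among EXCEPTIONAL corners only».

WHAT THIS FILE TYPES AND PROVES (0 sorry; imports = two landed Theorems files + HarnessLib; the g6 workfile is not importable on
the farm — Cruxes modules are unbuilt — so the three g6 facts used are re-proved here in ADDITIVE form, credited):

§1 PRODUCT-CURRENCY DICTIONARY (new, kernel).  `transversal_of_mem_logVisible`: every log-visible point `l` (tails with zero
   constant terms) is a TRANSVERSAL LETTER SUM — `l = Σ_{j ∈ I} e_j` with `e_j ∈ supp u_j` for all `j ∈ I ⊆ Fin m`, or the same on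
   the `v` side (via the landed `stub_logLinearisation`: log-tops = tops of `∏(1+u) − ∏(1+v)`, then `Finset.prod_add` +
   `support_mul`).  Hence (`three_le_of_deep`) a DEEP visible point — not a letter, not a sum of two letters — uses `≥ 3` rows, so
   `m ≥ 3` (`no_deep_of_le_two`): at `m ≤ 2` there are NO deep visible points, for every instance (the kernel form of neg-1's
   m = 2 parity fact (J′), in the shadow dictionary: E_T/SQ/DIAG corners are all SHALLOW).
§2 PRIVACY, additive form (= g6 K5 `eq_of_shadow_eq`, re-proved): in one weight-order cell two tops `x + a`, `x + a'` over a
   common point `x` with letters `a, a'` coincide; so the 2-sums of a cell family inject into the letters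
   (`card_twoSums_le`) and `#S ≤ 2·#letters + #deep(S)` per cell, ALL `m` (`cell_card_le_deep`; g6 `card_le_two_sums` is the
   log-currency form).  With §1: per cell, `m ≤ 2` ⇒ `#S ≤ 2·#letters` (`cell_card_le_of_le_two`) — a CALIBRATION ONLY: the landed
   `PlanarCell.planarCell_two_linear` / `planarCellBound_two_linear` (`…PlanarCellTwo.lean`, val-lit-p3 g13: `≤ #E/2 + 2 ≤ 2t+2`,
   nesting) is SHARPER, and `mem_tailSupport_or_add_of_mem_support_tailDiff` there is §1 at `m = 2`; nothing new is claimed at m = 2.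
§3 THE TYPED (J)-COUNTS.  `DeepCellBound` («per cell, #deep visible points ≤ 2^{am}(t+2)^b») `↔ PlanarCellBound` (kernel,
   `deepCellBound_iff_planarCellBound`) `→ TwoProducts` (`twoProducts_of_deepCellBound`, via the landed p596451); the polynomial
   shape the critic asked for, `DeepCellLinear` («≤ C·m^c·t», s = t = letters per row) `→ DeepCellBound` (`deepCellBound_of_linear`);
   and `DeepPrivacyGlobal` («across cells, two deep visible points never share a genuine one-letter shadow point») — TYPED ONLY and
   FALSE on the SV instance (m = 4: the deep corners 2T+a, 2T+b share the genuine shadow 2T; hand/scripted instance in the memo,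
   kernel companion = a Negative-lane item).  Reading: with g6 (`#genPairs = #genShadow` per cell, l.408) the «multiplicity» branch
   adds nothing per cell, the «exceptional privacy» branch is a per-cell theorem and globally false, so the narrowed (J) COLLAPSES to
   ONE object, `DeepCellBound` ⟺ PCB; its only sub-crux content is the SHAPE `DeepCellLinear`, first contentful at m = 3 (F3; E_B).

HONEST FRAME: bookkeeping + three small theorems; nothing here bounds `#deep`; `PlanarCellBound`, `ResidualLawV25`, `TwoProducts`
are OPEN and UNMOVED; VP ≠ VNP is NOT proved.  No instances, no notation, no new axioms. [folklore]
-/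

noncomputable section

set_option linter.dupNamespace false

open scoped BigOperators Classical Pointwise
open MvPolynomial
open Summit.ValiantsHypothesis.ValiantsHypothesis.Theorems.NewtonUnitEquations.TwoProducts.FormalLogLinearisation
open Summit.ValiantsHypothesis.ValiantsHypothesis.Theorems.NewtonUnitEquations.TwoProducts.PlanarCell

namespace Summit.ValiantsHypothesis.ValiantsHypothesis.Cruxes.TwoProducts.JCount

variable {m : ℕ}

/-! ## §1 Product currency: visible points are transversal letter sums -/

/-- A support point of a finite product is a transversal sum of support points of the factors. [folklore] -/
theorem exists_transversal_of_mem_support_prod {ι : Type*} (s : Finset ι) (f : ι → MvPolynomial (Fin 2) ℂ)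
    {x : Expo} (hx : x ∈ (∏ i ∈ s, f i).support) :
    ∃ g : ι → Expo, (∀ i ∈ s, g i ∈ (f i).support) ∧ ∑ i ∈ s, g i = x := by
  classical
  induction s using Finset.induction_on generalizing x with
  | empty =>
      rw [Finset.prod_empty] at hx
      have hx0 : x = 0 := by
        by_contra h
        exact (mem_support_iff.1 hx) (by rw [MvPolynomial.coeff_one, if_neg (Ne.symm h)])
      exact ⟨fun _ => 0, fun i hi => absurd hi (Finset.notMem_empty i), by simp [hx0]⟩
  | insert a s ha ih =>
      rw [Finset.prod_insert ha] at hx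
      obtain ⟨y, hy, z, hz, hyz⟩ := Finset.mem_add.1 (support_mul _ _ hx)
      obtain ⟨g, hg, hgz⟩ := ih hz
      refine ⟨Function.update g a y, fun i hi => ?_, ?_⟩
      · rcases Finset.mem_insert.1 hi with rfl | hi
        · rw [Function.update_self]; exact hy
        · rw [Function.update_of_ne (fun h => ha (by rw [← h]; exact hi))]; exact hg i hi
      · rw [Finset.sum_insert ha, Function.update_self, ← hyz, ← hgz]
        congr 1
        exact Finset.sum_congr rfl fun i hi => Function.update_of_ne (fun h => ha (by rw [← h]; exact hi)) _ _

/-- `x` is a TRANSVERSAL SUM for the rows `w`: `x = Σ_{j ∈ I} g j` with `g j ∈ supp (w j)` on `I`. [this file] -/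
def IsTransversal (w : Fin m → MvPolynomial (Fin 2) ℂ) (x : Expo) : Prop :=
  ∃ I : Finset (Fin m), ∃ g : Fin m → Expo, (∀ j ∈ I, g j ∈ (w j).support) ∧ ∑ j ∈ I, g j = x

/-- A support point of `∏_j (1 + w_j)` is a transversal sum (expand with `Finset.prod_add`). [folklore] -/
theorem isTransversal_of_mem_support_prod_one_add (w : Fin m → MvPolynomial (Fin 2) ℂ) {x : Expo}
    (hx : x ∈ (∏ j, (1 + w j)).support) : IsTransversal w x := by
  classical
  have hexp : ∏ j, (1 + w j) = ∑ I ∈ (Finset.univ : Finset (Fin m)).powerset, ∏ j ∈ I, w j := by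
    simp_rw [add_comm (1 : MvPolynomial (Fin 2) ℂ)]
    rw [Finset.prod_add]
    refine Finset.sum_congr rfl fun I _ => ?_
    rw [Finset.prod_const_one, mul_one]
  rw [hexp] at hx
  obtain ⟨I, -, hI⟩ := Finset.mem_biUnion.1 (support_sum hx)
  obtain ⟨g, hg, hgx⟩ := exists_transversal_of_mem_support_prod I w hI
  exact ⟨I, g, hg, hgx⟩

/-- A support point of `∏(1+u_j) − ∏(1+v_j)` is a transversal sum on the `u` side or on the `v` side. [folklore] -/
theorem isTransversal_of_mem_support_tailDiff (u v : Fin m → MvPolynomial (Fin 2) ℂ) {x : Expo}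
    (hx : x ∈ (tailDiff u v).support) : IsTransversal u x ∨ IsTransversal v x := by
  unfold tailDiff at hx
  rcases Finset.mem_union.1 (support_sub _ _ _ hx) with h | h
  · exact Or.inl (isTransversal_of_mem_support_prod_one_add u h)
  · exact Or.inr (isTransversal_of_mem_support_prod_one_add v h)

/-- **Dictionary.** Every log-visible point of a tails instance is a transversal letter sum (`u` side or `v` side). [this file] -/
theorem transversal_of_mem_logVisible {u v : Fin m → MvPolynomial (Fin 2) ℂ} (hu : ∀ j, coeff 0 (u j) = 0)
    (hv : ∀ j, coeff 0 (v j) = 0) {l : Expo} (hl : l ∈ logVisible u v) : IsTransversal u l ∨ IsTransversal v l := by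
  obtain ⟨ξ, hξ, htop⟩ := hl
  have htop' : IsStrictTop ξ ↑(tailDiff u v).support l := (stub_logLinearisation m u v hu hv ξ hξ l).mpr htop
  exact isTransversal_of_mem_support_tailDiff u v (Finset.mem_coe.1 htop'.1)

/-- DEEP points (product currency; the complement of g6's «letters or sums of two letters», `card_le_two_sums`): not a letter and
not a sum of two letters. [this file] -/
def IsDeep (u v : Fin m → MvPolynomial (Fin 2) ℂ) (l : Expo) : Prop :=
  l ∉ tailSupport u v ∧ ¬ ∃ a ∈ tailSupport u v, ∃ a' ∈ tailSupport u v, l = a + a'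

/-- A transversal representation of a DEEP nonzero point uses at least three rows. [this file] -/
theorem three_le_card_of_deep {u v : Fin m → MvPolynomial (Fin 2) ℂ} (w : Fin m → MvPolynomial (Fin 2) ℂ)
    (hw : ∀ j, ∀ e ∈ (w j).support, e ∈ tailSupport u v) {l : Expo} (hl0 : l ≠ 0) (hd : IsDeep u v l)
    {I : Finset (Fin m)} {g : Fin m → Expo} (hg : ∀ j ∈ I, g j ∈ (w j).support) (hsum : ∑ j ∈ I, g j = l) :
    3 ≤ I.card := by
  by_contra hlt
  push Not at hlt
  interval_cases hI : I.card
  · rw [Finset.card_eq_zero] at hI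
    subst hI
    rw [Finset.sum_empty] at hsum
    exact hl0 hsum.symm
  · obtain ⟨j, rfl⟩ := Finset.card_eq_one.1 hI
    rw [Finset.sum_singleton] at hsum
    exact hd.1 (hsum ▸ hw j _ (hg j (Finset.mem_singleton_self j)))
  · obtain ⟨j, j', hjj', rfl⟩ := Finset.card_eq_two.1 hI
    rw [Finset.sum_pair hjj'] at hsum
    exact hd.2 ⟨g j, hw j _ (hg j (by simp)), g j', hw j' _ (hg j' (by simp)), hsum.symm⟩

/-- **Deep visible points use ≥ 3 rows; in particular `m ≥ 3`.** [this file] -/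
theorem three_le_of_deep {u v : Fin m → MvPolynomial (Fin 2) ℂ} (hu : ∀ j, coeff 0 (u j) = 0)
    (hv : ∀ j, coeff 0 (v j) = 0) {l : Expo} (hl : l ∈ logVisible u v) (hd : IsDeep u v l) : 3 ≤ m := by
  have hl0 : l ≠ 0 := by
    obtain ⟨ξ, -, htop⟩ := hl
    intro h
    have hmem : l ∈ logSupport u v := htop.1
    rw [h] at hmem
    exact hmem (logDiff_zero u v)
  rcases transversal_of_mem_logVisible hu hv hl with ⟨I, g, hg, hsum⟩ | ⟨I, g, hg, hsum⟩
  · have h3 := three_le_card_of_deep u (fun j e he => mem_tailSupport_u he) hl0 hd hg hsum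
    exact h3.trans ((Finset.card_le_univ I).trans (by simp))
  · have h3 := three_le_card_of_deep v (fun j e he => mem_tailSupport_v he) hl0 hd hg hsum
    exact h3.trans ((Finset.card_le_univ I).trans (by simp))
where
  /-- letters of `u j` are letters -/
  mem_tailSupport_u {u v : Fin m → MvPolynomial (Fin 2) ℂ} {j : Fin m} {e : Expo} (he : e ∈ (u j).support) :
      e ∈ tailSupport u v :=
    Finset.mem_union.2 (Or.inl (Finset.mem_biUnion.2 ⟨j, Finset.mem_univ _, he⟩))
  /-- letters of `v j` are letters -/
  mem_tailSupport_v {u v : Fin m → MvPolynomial (Fin 2) ℂ} {j : Fin m} {e : Expo} (he : e ∈ (v j).support) :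
      e ∈ tailSupport u v :=
    Finset.mem_union.2 (Or.inr (Finset.mem_biUnion.2 ⟨j, Finset.mem_univ _, he⟩))

/-- **No deep visible points at `m ≤ 2`** (every instance, every cell). [this file] -/
theorem no_deep_of_le_two {u v : Fin m → MvPolynomial (Fin 2) ℂ} (hm : m ≤ 2) (hu : ∀ j, coeff 0 (u j) = 0)
    (hv : ∀ j, coeff 0 (v j) = 0) {l : Expo} (hl : l ∈ logVisible u v) : ¬ IsDeep u v l :=
  fun hd => by have := three_le_of_deep hu hv hl hd; omega

/-! ## §2 Privacy in a cell, additive form (g6 K5 re-proved), and the per-cell squeeze down to the deep points -/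

theorem wt_add' (ξ : Fin 2 → ℝ) (a b : Expo) : wt ξ (a + b) = wt ξ a + wt ξ b := by
  simp only [wt, Finsupp.add_apply, Nat.cast_add]; ring

/-- Letters have negative weight under a valid weight (g6). [folklore] -/
theorem wt_neg_of_mem_tailSupport {u v : Fin m → MvPolynomial (Fin 2) ℂ} {ξ : Fin 2 → ℝ} (hval : ValidWeight u v ξ)
    {a : Expo} (ha : a ∈ tailSupport u v) : wt ξ a < 0 := by
  rcases Finset.mem_union.1 ha with h | h
  · obtain ⟨j, -, hj⟩ := Finset.mem_biUnion.1 h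
    exact hval.1 j a hj
  · obtain ⟨j, -, hj⟩ := Finset.mem_biUnion.1 h
    exact hval.2 j a hj

/-- **PRIVACY (additive form of g6 `eq_of_shadow_eq`).** In one weight-order cell, two members `x + a`, `x + a'` over a common
point `x` with letters `a, a'` are equal. [folklore] -/
theorem eq_of_common_shadow {u v : Fin m → MvPolynomial (Fin 2) ℂ} {R : Expo → Expo → Prop} {S : Finset Expo}
    (hS : IsCellFamily u v R S) {x a a' : Expo} (hl : x + a ∈ S) (hl' : x + a' ∈ S) (ha : a ∈ tailSupport u v)
    (ha' : a' ∈ tailSupport u v) : x + a = x + a' := by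
  by_contra hne
  obtain ⟨ξ, hval, htop, hR⟩ := hS _ hl
  obtain ⟨ξ', hval', htop', hR'⟩ := hS _ hl'
  have h1 : wt ξ (x + a') < wt ξ (x + a) := htop.2 _ htop'.1 (Ne.symm hne)
  have h2 : wt ξ' (x + a) < wt ξ' (x + a') := htop'.2 _ htop.1 hne
  rw [wt_add', wt_add'] at h1 h2
  by_cases hRaa' : R a a'
  · have hw : wt ξ a ≤ wt ξ a' := (hR a ha a' ha').1 hRaa'
    linarith
  · have hw : ¬ (wt ξ' a ≤ wt ξ' a') := fun hh => hRaa' ((hR' a ha a' ha').2 hh)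
    push Not at hw
    linarith

/-- The members of `S` that are sums of two letters. [this file] -/
def twoSums (u v : Fin m → MvPolynomial (Fin 2) ℂ) (S : Finset Expo) : Finset Expo :=
  S.filter fun l => ∃ a ∈ tailSupport u v, ∃ a' ∈ tailSupport u v, l = a + a'

/-- The DEEP members of `S`. [this file] -/
def deep (u v : Fin m → MvPolynomial (Fin 2) ℂ) (S : Finset Expo) : Finset Expo :=
  S.filter fun l => IsDeep u v l

theorem deep_subset (u v : Fin m → MvPolynomial (Fin 2) ℂ) (S : Finset Expo) : deep u v S ⊆ S := Finset.filter_subset _ _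

/-- **2-sums of a cell family inject into the letters** (send `a + a' ↦ a'`; privacy makes it injective). [this file] -/
theorem card_twoSums_le {u v : Fin m → MvPolynomial (Fin 2) ℂ} {R : Expo → Expo → Prop} {S : Finset Expo}
    (hS : IsCellFamily u v R S) : (twoSums u v S).card ≤ (tailSupport u v).card := by
  have key : ∀ l ∈ twoSums u v S, ∃ a ∈ tailSupport u v, ∃ a' ∈ tailSupport u v, l = a + a' :=
    fun l hl => (Finset.mem_filter.1 hl).2
  choose! fa hfa fa' hfa' hf using key
  refine Finset.card_le_card_of_injOn fa' (fun l hl => hfa' l (Finset.mem_coe.1 hl)) ?_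
  intro l hl l' hl' h
  have hlm : l ∈ twoSums u v S := Finset.mem_coe.1 hl
  have hlm' : l' ∈ twoSums u v S := Finset.mem_coe.1 hl'
  have hlS : l ∈ S := (Finset.mem_filter.1 hlm).1
  have hlS' : l' ∈ S := (Finset.mem_filter.1 hlm').1
  have e1 : fa' l + fa l = l := by rw [add_comm]; exact (hf l hlm).symm
  have e2 : fa' l + fa l' = l' := by rw [h, add_comm]; exact (hf l' hlm').symm
  have hx1 : fa' l + fa l ∈ S := by rw [e1]; exact hlS
  have hx2 : fa' l + fa l' ∈ S := by rw [e2]; exact hlS'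
  have key := eq_of_common_shadow hS hx1 hx2 (hfa l hlm) (hfa l' hlm')
  rw [e1, e2] at key
  exact key

/-- **Per-cell squeeze down to the deep points:** `#S ≤ 2·#letters + #deep S`. [this file] -/
theorem cell_card_le_deep {u v : Fin m → MvPolynomial (Fin 2) ℂ} {R : Expo → Expo → Prop} {S : Finset Expo}
    (hS : IsCellFamily u v R S) : S.card ≤ 2 * (tailSupport u v).card + (deep u v S).card := by
  have hsub : S ⊆ (S ∩ tailSupport u v) ∪ twoSums u v S ∪ deep u v S := by
    intro l hl
    by_cases h1 : l ∈ tailSupport u v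
    · exact Finset.mem_union.2 (Or.inl (Finset.mem_union.2 (Or.inl (Finset.mem_inter.2 ⟨hl, h1⟩))))
    · by_cases h2 : ∃ a ∈ tailSupport u v, ∃ a' ∈ tailSupport u v, l = a + a'
      · exact Finset.mem_union.2 (Or.inl (Finset.mem_union.2 (Or.inr (Finset.mem_filter.2 ⟨hl, h2⟩))))
      · exact Finset.mem_union.2 (Or.inr (Finset.mem_filter.2 ⟨hl, h1, h2⟩))
  calc S.card ≤ ((S ∩ tailSupport u v) ∪ twoSums u v S ∪ deep u v S).card := Finset.card_le_card hsub
    _ ≤ ((S ∩ tailSupport u v) ∪ twoSums u v S).card + (deep u v S).card := Finset.card_union_le _ _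
    _ ≤ (S ∩ tailSupport u v).card + (twoSums u v S).card + (deep u v S).card :=
        Nat.add_le_add_right (Finset.card_union_le _ _) _
    _ ≤ (tailSupport u v).card + (tailSupport u v).card + (deep u v S).card :=
        Nat.add_le_add_right (add_le_add (Finset.card_le_card Finset.inter_subset_right) (card_twoSums_le hS)) _
    _ = 2 * (tailSupport u v).card + (deep u v S).card := by ring

/-- The tail support of a `t`-sparse instance has at most `2mt` letters (g6). [folklore] -/
theorem card_tailSupport_le (u v : Fin m → MvPolynomial (Fin 2) ℂ) (t : ℕ) (hu : ∀ j, (u j).support.card ≤ t)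
    (hv : ∀ j, (v j).support.card ≤ t) : (tailSupport u v).card ≤ 2 * m * t := by
  unfold tailSupport
  have h1 : (Finset.univ.biUnion fun j => (u j).support).card ≤ m * t :=
    calc (Finset.univ.biUnion fun j => (u j).support).card ≤ ∑ j, (u j).support.card := Finset.card_biUnion_le
      _ ≤ ∑ _j : Fin m, t := Finset.sum_le_sum fun j _ => hu j
      _ = m * t := by simp
  have h2 : (Finset.univ.biUnion fun j => (v j).support).card ≤ m * t :=
    calc (Finset.univ.biUnion fun j => (v j).support).card ≤ ∑ j, (v j).support.card := Finset.card_biUnion_le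
      _ ≤ ∑ _j : Fin m, t := Finset.sum_le_sum fun j _ => hv j
      _ = m * t := by simp
  calc _ ≤ (Finset.univ.biUnion fun j => (u j).support).card + (Finset.univ.biUnion fun j => (v j).support).card :=
        Finset.card_union_le _ _
    _ ≤ m * t + m * t := add_le_add h1 h2
    _ = 2 * m * t := by ring

/-- Calibration at `m ≤ 2`: per cell `#S ≤ 2·#letters` (no deep points exist).  WEAKER re-derivation of the landed
`PlanarCell.planarCell_two_linear` (`#S ≤ #E/2 + 2`, nesting; `…Theorems/NewtonUnitEquationsTwoProductsPlanarCellTwo.lean`) — cited, not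
claimed; kept only as the `m ≤ 2` sanity check of the deep/2-sum split. [folklore] -/
theorem cell_card_le_of_le_two {u v : Fin m → MvPolynomial (Fin 2) ℂ} (hm : m ≤ 2) (hu : ∀ j, coeff 0 (u j) = 0)
    (hv : ∀ j, coeff 0 (v j) = 0) {R : Expo → Expo → Prop} {S : Finset Expo} (hS : IsCellFamily u v R S) :
    S.card ≤ 2 * (tailSupport u v).card := by
  have hdeep : deep u v S = ∅ := by
    refine Finset.eq_empty_of_forall_notMem fun l hl => ?_
    obtain ⟨hlS, hd⟩ := Finset.mem_filter.1 hl
    obtain ⟨ξ, hval, htop, -⟩ := hS l hlS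
    exact no_deep_of_le_two hm hu hv ⟨ξ, hval, htop⟩ hd
  have h := cell_card_le_deep hS
  rw [hdeep, Finset.card_empty, add_zero] at h
  exact h

/-! ## §3 The typed (J)-counts -/

/-- VERBATIM `PlanarCellBound` (the hypothesis of the landed `twoProducts_of_planarCellBound`, p596451). -/
def PlanarCellBound : Prop :=
  ∃ a b : ℕ, ∀ (m t : ℕ), 2 ≤ t → ∀ (u v : Fin m → MvPolynomial (Fin 2) ℂ),
    (∀ j, coeff 0 (u j) = 0 ∧ (u j).support.card ≤ t) → (∀ j, coeff 0 (v j) = 0 ∧ (v j).support.card ≤ t) →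
    ∀ (R : Expo → Expo → Prop) (S : Finset Expo),
      (∀ l ∈ S, ∃ ξ : Fin 2 → ℝ, ValidWeight u v ξ ∧ IsStrictTop ξ (logSupport u v) l ∧
        ∀ e ∈ ((Finset.univ.biUnion fun j => (u j).support) ∪ Finset.univ.biUnion fun j => (v j).support),
        ∀ e' ∈ ((Finset.univ.biUnion fun j => (u j).support) ∪ Finset.univ.biUnion fun j => (v j).support),
          (R e e' ↔ wt ξ e ≤ wt ξ e')) →
      S.card ≤ 2 ^ (a * m) * (t + 2) ^ b

/-- **(J) — DEEP CELL BOUND**: per weight-order cell, the DEEP visible points (not a letter, not a sum of two letters) number at most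
`2^{am}(t+2)^b`.  The residual of the line of record in product currency. [this file] -/
def DeepCellBound : Prop :=
  ∃ a b : ℕ, ∀ (m t : ℕ), 2 ≤ t → ∀ (u v : Fin m → MvPolynomial (Fin 2) ℂ),
    (∀ j, coeff 0 (u j) = 0 ∧ (u j).support.card ≤ t) → (∀ j, coeff 0 (v j) = 0 ∧ (v j).support.card ≤ t) →
    ∀ (R : Expo → Expo → Prop) (S : Finset Expo), IsCellFamily u v R S →
      (deep u v S).card ≤ 2 ^ (a * m) * (t + 2) ^ b

/-- **(J-lin) — the polynomial SHAPE the critic asked for** («`≤ C·m^c·s`», `s = t` = letters per row): per cell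
`#deep ≤ C·m^c·t`.  An S⁺ of `DeepCellBound`; first contentful class `m = 3` (F3); nothing here proves it. [this file] -/
def DeepCellLinear : Prop :=
  ∃ C c : ℕ, ∀ (m t : ℕ), 2 ≤ t → ∀ (u v : Fin m → MvPolynomial (Fin 2) ℂ),
    (∀ j, coeff 0 (u j) = 0 ∧ (u j).support.card ≤ t) → (∀ j, coeff 0 (v j) = 0 ∧ (v j).support.card ≤ t) →
    ∀ (R : Expo → Expo → Prop) (S : Finset Expo), IsCellFamily u v R S →
      (deep u v S).card ≤ C * m ^ c * t

/-- **(J-priv) — GLOBAL DEEP PRIVACY** («privacy among exceptional corners only», across cells): two deep log-visible points that sit one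
letter above a COMMON point coincide.  TYPED ONLY.  Per cell it is a theorem (`eq_of_common_shadow`); globally it is FALSE at `m = 4`
on the SV instance of val-idea-crit-8 g3 (rows `(a,a,b,b)` vs `(a+T, a−T, b+iT, b−iT)`, `a=(2,4)`, `b=(4,2)`, `T=(64,1)`: the deep
visible points `2T+a = (130,6)` and `2T+b = (132,4)` share the point `2T = (128,2)`, a genuine shadow of both — memo §2, scripted
instance table `jcount_instances.txt`); a kernel companion belongs to the Negative lane. [this file] -/
def DeepPrivacyGlobal : Prop :=
  ∀ (m : ℕ) (u v : Fin m → MvPolynomial (Fin 2) ℂ), (∀ j, coeff 0 (u j) = 0) → (∀ j, coeff 0 (v j) = 0) →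
    ∀ x a a' : Expo, a ∈ tailSupport u v → a' ∈ tailSupport u v →
      x + a ∈ logVisible u v → x + a' ∈ logVisible u v → IsDeep u v (x + a) → IsDeep u v (x + a') → x + a = x + a'

/-- Arithmetic: `4mt + X ≤ X · (2^m (t+2)^2)` for `X ≥ 1`. [folklore] -/
theorem deep_arith (a b m t : ℕ) : 4 * m * t + 2 ^ (a * m) * (t + 2) ^ b ≤ 2 ^ ((a + 1) * m) * (t + 2) ^ (b + 2) := by
  have hX : 1 ≤ 2 ^ (a * m) * (t + 2) ^ b := Nat.one_le_iff_ne_zero.2 (by positivity)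
  have hm : m + 1 ≤ 2 ^ m := Nat.lt_two_pow_self
  have hY : 4 * m * t + 1 ≤ 2 ^ m * (t + 2) ^ 2 := by
    have h1 : (m + 1) * (t + 2) ^ 2 ≤ 2 ^ m * (t + 2) ^ 2 := Nat.mul_le_mul_right _ hm
    have h2 : (m + 1) * (t + 2) ^ 2 = 4 * m * t + 1 + (m * t ^ 2 + 4 * m + t ^ 2 + 4 * t + 3) := by ring
    have h3 : 4 * m * t + 1 ≤ (m + 1) * (t + 2) ^ 2 := by rw [h2]; exact Nat.le_add_right _ _
    exact h3.trans h1
  have hsplit : 2 ^ ((a + 1) * m) * (t + 2) ^ (b + 2) = (2 ^ (a * m) * (t + 2) ^ b) * (2 ^ m * (t + 2) ^ 2) := by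
    rw [add_mul, one_mul, pow_add, pow_add]; ring
  rw [hsplit]
  set X := 2 ^ (a * m) * (t + 2) ^ b
  set Y := 2 ^ m * (t + 2) ^ 2
  have hXpos : 0 < X := hX
  calc 4 * m * t + X ≤ X * (4 * m * t) + X * 1 :=
        Nat.add_le_add (Nat.le_mul_of_pos_left _ hXpos) (by rw [mul_one])
    _ = X * (4 * m * t + 1) := by ring
    _ ≤ X * Y := Nat.mul_le_mul_left _ hY

/-- **`DeepCellBound → PlanarCellBound`** (per-cell squeeze `#S ≤ 4mt + #deep` + arithmetic). [this file] -/
theorem planarCellBound_of_deepCellBound (h : DeepCellBound) : PlanarCellBound := by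
  obtain ⟨a, b, hab⟩ := h
  refine ⟨a + 1, b + 2, ?_⟩
  intro m t ht u v hu hv R S hS
  have hcell : IsCellFamily u v R S := hS
  calc S.card ≤ 2 * (tailSupport u v).card + (deep u v S).card := cell_card_le_deep hcell
    _ ≤ 2 * (2 * m * t) + (deep u v S).card :=
        Nat.add_le_add_right (Nat.mul_le_mul_left _ (card_tailSupport_le u v t (fun j => (hu j).2) fun j => (hv j).2)) _
    _ = 4 * m * t + (deep u v S).card := by ring
    _ ≤ 4 * m * t + 2 ^ (a * m) * (t + 2) ^ b := Nat.add_le_add_left (hab m t ht u v hu hv R S hcell) _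
    _ ≤ 2 ^ ((a + 1) * m) * (t + 2) ^ (b + 2) := deep_arith a b m t

/-- **`PlanarCellBound → DeepCellBound`** (`deep S ⊆ S` is itself a cell family). [this file] -/
theorem deepCellBound_of_planarCellBound (h : PlanarCellBound) : DeepCellBound := by
  obtain ⟨a, b, hab⟩ := h
  refine ⟨a, b, fun m t ht u v hu hv R S hS => ?_⟩
  have hsub : IsCellFamily u v R (deep u v S) := fun l hl => hS l (deep_subset u v S hl)
  exact hab m t ht u v hu hv R (deep u v S) hsub

/-- **The narrowed junction (J) is ONE object: `DeepCellBound ↔ PlanarCellBound`.** [this file] -/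
theorem deepCellBound_iff_planarCellBound : DeepCellBound ↔ PlanarCellBound :=
  ⟨planarCellBound_of_deepCellBound, deepCellBound_of_planarCellBound⟩

/-- Arithmetic for the polynomial shape: `C·m^c·t ≤ 2^{(C+c)m}(t+2)^{C+1}`. [folklore] -/
theorem linear_arith (C c m t : ℕ) : C * m ^ c * t ≤ 2 ^ ((C + c) * m) * (t + 2) ^ (C + 1) := by
  have hC : C ≤ 2 ^ C := (Nat.lt_two_pow_self).le
  have ht : t ≤ t + 2 := by omega
  rcases Nat.eq_zero_or_pos m with rfl | hm
  · rcases Nat.eq_zero_or_pos c with rfl | hc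
    · simp only [pow_zero, mul_one, Nat.add_zero, mul_zero, one_mul]
      calc C * t ≤ 2 ^ C * (t + 2) := Nat.mul_le_mul hC ht
        _ ≤ (t + 2) ^ C * (t + 2) := Nat.mul_le_mul_right _ (Nat.pow_le_pow_left (by omega) C)
        _ = (t + 2) ^ (C + 1) := by rw [pow_succ]
    · rw [zero_pow (by omega), mul_zero, zero_mul]; exact Nat.zero_le _
  · have h1 : C ≤ 2 ^ (C * m) := hC.trans (Nat.pow_le_pow_right (by norm_num) (Nat.le_mul_of_pos_right C hm))
    have h2 : m ^ c ≤ 2 ^ (c * m) := by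
      calc m ^ c ≤ (2 ^ m) ^ c := Nat.pow_le_pow_left (Nat.lt_two_pow_self).le c
        _ = 2 ^ (c * m) := by rw [← pow_mul, mul_comm]
    have h3 : t ≤ (t + 2) ^ (C + 1) := by
      calc t ≤ t + 2 := ht
        _ = (t + 2) ^ 1 := (pow_one _).symm
        _ ≤ (t + 2) ^ (C + 1) := Nat.pow_le_pow_right (by omega) (by omega)
    calc C * m ^ c * t ≤ 2 ^ (C * m) * 2 ^ (c * m) * (t + 2) ^ (C + 1) :=
          Nat.mul_le_mul (Nat.mul_le_mul h1 h2) h3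
      _ = 2 ^ ((C + c) * m) * (t + 2) ^ (C + 1) := by rw [← pow_add, add_mul]

/-- **`DeepCellLinear → DeepCellBound`** (the polynomial shape implies the currency). [this file] -/
theorem deepCellBound_of_linear (h : DeepCellLinear) : DeepCellBound := by
  obtain ⟨C, c, hC⟩ := h
  exact ⟨C + c, C + 1, fun m t ht u v hu hv R S hS => (hC m t ht u v hu hv R S hS).trans (linear_arith C c m t)⟩

/-- **`DeepCellBound → TwoProducts`** (through the landed `twoProducts_of_planarCellBound`, p596451). [this file] -/
theorem twoProducts_of_deepCellBound (h : DeepCellBound) :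
    Summit.ValiantsHypothesis.ValiantsHypothesis.Theses.NewtonUnitEquations.TwoProducts :=
  twoProducts_of_planarCellBound (planarCellBound_of_deepCellBound h)

/-- **`DeepCellLinear → TwoProducts`**. [this file] -/
theorem twoProducts_of_deepCellLinear (h : DeepCellLinear) :
    Summit.ValiantsHypothesis.ValiantsHypothesis.Theses.NewtonUnitEquations.TwoProducts :=
  twoProducts_of_deepCellBound (deepCellBound_of_linear h)

end Summit.ValiantsHypothesis.ValiantsHypothesis.Cruxes.TwoProducts.JCount

end
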